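import Mathlib
import Summits.ABC.ABC.Theses.IneffectiveSubspace

/-!
# Crux `DepthCountedABC` (stmt-ABC-14938) — ideator 1, round 1: first lemmas for two crux ideas

* Card `depth-grouped-four-logarithms`: `DepthDecomposition` (L0), `LW4`, `S4SmallMemberABC`,
  `L1`–`L3`, `RadicalLikeCell`.
* Card `signature-routing`: `SignatureBound`, `AutomaticCell`, `PolyDG`, `HyperbolicTrio`.

Everything here is a `def … : Prop` (statements only, no proofs claimed); the target is the route
decl `Summit.ABC.ABC.Theses.IneffectiveSubspace.DepthCountedABC`.
-/

namespace Summit.ABC.ABC.Cruxes.DepthCountedABC.Ideator1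

open Literature.NumberTheory.DiophantineGeometry
open scoped BigOperators

/-- The crux, by name. -/
def Target : Prop := Summit.ABC.ABC.Theses.IneffectiveSubspace.DepthCountedABC

/-- `n` is 5-free: every prime divides `n` to exponent ≤ 4. -/
def FiveFree (n : ℕ) : Prop := ∀ p ∈ n.primeFactors, n.factorization p ≤ 4

/-- depth-`j` part of `n`: the product of the primes dividing `n` to exponent exactly `j`. -/
noncomputable def depthPart (n j : ℕ) : ℕ :=
  ∏ p ∈ n.primeFactors.filter (fun p => n.factorization p = j), p

/-- level-4 radical `S₄(n) = ∏ p^⌈v_p(n)/4⌉` (the route's `rad₄`). -/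
noncomputable def S4 (n : ℕ) : ℕ :=
  ∏ p ∈ n.primeFactors, p ^ ((n.factorization p + 3) / 4)

/-- **L0** (provable now): depth decomposition, radical and `S₄` of a 5-free number. -/
def DepthDecomposition : Prop :=
  ∀ n : ℕ, n ≠ 0 → FiveFree n →
    n = ∏ j ∈ Finset.Icc 1 4, depthPart n j ^ j ∧
    UniqueFactorizationMonoid.radical n = ∏ j ∈ Finset.Icc 1 4, depthPart n j ∧
    S4 n = UniqueFactorizationMonoid.radical n

/-- The four-logarithm form `Λ₄(x) = Σ_{j=1}^{4} j · log x_j` on positive rationals. -/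
noncomputable def fourLog (x : Fin 4 → ℚ) : ℝ :=
  ∑ j : Fin 4, ((j.val : ℝ) + 1) * Real.log ((x j : ℚ) : ℝ)

/-- multiplicative (product) height `∏_j num(x_j) · den(x_j)`. -/
def prodHeight (x : Fin 4 → ℚ) : ℕ :=
  ∏ j : Fin 4, (x j).num.natAbs * (x j).den

/-- **LW4**: the Lang–Waldschmidt / Baker sum-of-heights lower bound for the SINGLE linear form
`Λ₄` in four logarithms of rationals with the fixed coefficient vector `(1,2,3,4)`, at the
archimedean place, with multiplicative heights. -/
def LW4 : Prop :=
  ∀ ε : ℝ, 0 < ε → ∃ C : ℝ, 0 < C ∧ ∀ x : Fin 4 → ℚ, (∀ j, 0 < x j) → fourLog x ≠ 0 →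
    C⁻¹ * ((prodHeight x : ℕ) : ℝ) ^ (-(1 + ε)) ≤ |fourLog x|

/-- Arithmetic face of `LW4`: abc with the small member `a` counted at full size and the two
large members through their level-4 radicals `S₄`. -/
def S4SmallMemberABC : Prop :=
  ∀ ε : ℝ, 0 < ε → ∃ C : ℝ, 0 < C ∧ ∀ a b c : ℕ, IsABCTriple a b c →
    (c : ℝ) ≤ C * (a : ℝ) * ((S4 b * S4 c : ℕ) : ℝ) ^ (1 + ε)

/-- **L1** (elementary; provable now up to bookkeeping): `LW4 ↔ S4SmallMemberABC`
(`|log(c/b)| ≍ a/c`; the minimum of `prodHeight` over all `x` with `∏ x_j^j = c/b` is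
`S₄(b)S₄(c)`). -/
def L1 : Prop := LW4 ↔ S4SmallMemberABC

/-- The radical-like sub-cell of the crux at `K = 0`: abc for 5-free triples whose small member
carries no powerful excess beyond `rad(a)^ε · c^ε`. Contains `a = 1`, every fixed `a`, every
Pell/unit family `(a, vY², wZ²)`, and the record 5-free triple `(1, 2⁴·5, 3⁴)`. -/
def RadicalLikeCell : Prop :=
  ∀ ε : ℝ, 0 < ε → ∃ C : ℝ, 0 < C ∧ ∀ a b c : ℕ, IsABCTriple a b c → FiveFree (a * b * c) →
    (a : ℝ) ≤ ((UniqueFactorizationMonoid.radical a : ℕ) : ℝ) ^ (1 + ε) * (c : ℝ) ^ ε →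
    (c : ℝ) < C * ((rad a b c : ℕ) : ℝ) ^ (1 + 4 * ε)

/-- **L2** (provable now from L0: `S₄ = rad` on 5-free numbers): -/
def L2 : Prop := S4SmallMemberABC → RadicalLikeCell

/-- **L3** (sanity, provable now): the summit implies the arithmetic face of `LW4`
(so the transfer target is not stronger than ABC). -/
def L3 : Prop := _root_.ABC → S4SmallMemberABC

/-! ### Card 2: signature routing -/

/-- canonical squarefree base of signature `r` of `n`: `x_r(n) = ∏_{v_p(n) ≥ r} p`;
for 5-free `n = A₁A₂²A₃³A₄⁴`: `x₄ = A₄`, `x₃ = A₃A₄`, `x₂ = A₂A₃A₄`, `x₁ = rad n`. -/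
noncomputable def sigBase (n r : ℕ) : ℕ :=
  ∏ p ∈ n.primeFactors.filter (fun p => r ≤ n.factorization p), p

/-- **SignatureBound** (provable now): for every choice of signatures the radical is divisible
by the product of the squarefree bases, and `x_r^r ∣ a` etc.  Consequence (real-analytic
bookkeeping): `rad(abc) ≥ (a/u_r)^{1/r} (b/v_s)^{1/s} (c/w_t)^{1/t}` with the cofactors
`u_r := a / x_r^r`, …, hence `quality ≤ 1/(1/r+1/s+1/t) + (cofactor mass)` on balanced cells. -/
def SignatureBound : Prop :=
  ∀ a b c r s t : ℕ, IsABCTriple a b c → 1 ≤ r → 1 ≤ s → 1 ≤ t →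
    sigBase a r * sigBase b s * sigBase c t ∣ rad a b c ∧
    sigBase a r ^ r ∣ a ∧ sigBase b s ^ s ∣ b ∧ sigBase c t ^ t ∣ c

/-- **AutomaticCell** (provable now): if two members are radical-like then abc holds outright
(`rad(abc) ≥ rad a · rad b ≥ (ab)^{1/(1+ε)} ≥ (c/2)^{1/(1+ε)}`). -/
def AutomaticCell : Prop :=
  ∀ ε : ℝ, 0 < ε → ∀ a b c : ℕ, IsABCTriple a b c →
    (a : ℝ) ≤ ((UniqueFactorizationMonoid.radical a : ℕ) : ℝ) ^ (1 + ε) →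
    (b : ℝ) ≤ ((UniqueFactorizationMonoid.radical b : ℕ) : ℝ) ^ (1 + ε) →
    (c : ℝ) ≤ 2 * ((rad a b c : ℕ) : ℝ) ^ (1 + ε)

/-- Hyperbolic core at polynomial strength for one bounded signature `(r,s,t)`: primitive
solutions of `u x^r + v y^s = w z^t` are polynomially bounded in the coefficients
(Darmon–Granville give finiteness for each fixed `(u,v,w)` when `1/r+1/s+1/t < 1`). -/
def PolyDG (r s t : ℕ) : Prop :=
  ∃ M C : ℝ, 0 < C ∧ ∀ u v w x y z : ℕ, 0 < u → 0 < v → 0 < w → 0 < x → 0 < y → 0 < z →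
    Nat.Coprime (u * x) (v * y) → u * x ^ r + v * y ^ s = w * z ^ t →
    ((x * y * z : ℕ) : ℝ) ≤ C * ((u * v * w : ℕ) : ℝ) ^ M

/-- The three hyperbolic bounded signatures (up to order) of the 5-free cell. -/
def HyperbolicTrio : Prop :=
  PolyDG 3 3 4 ∧ PolyDG 3 4 4 ∧ PolyDG 4 4 4 ∧ PolyDG 4 3 3 ∧ PolyDG 4 4 3 ∧ PolyDG 3 4 3 ∧
    PolyDG 4 3 4

/-- sanity for the automatic cell `(16, 65, 81)`: `rad = 390 > 81`. -/
example : (81 : ℕ) ≤ 2 * 390 := by norm_num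

end Summit.ABC.ABC.Cruxes.DepthCountedABC.Ideator1
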